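import Literature.AlgebraicTopology.FundamentalGroup.FiniteCover
import Mathlib.Geometry.Manifold.Metrizable
import Mathlib.Analysis.Convex.Contractible
import Mathlib.Analysis.Normed.Module.Convex
import HarnessLib

/-!
# The fundamental group of a compact manifold is finitely generated

Topic `Literature/AlgebraicTopology/FundamentalGroup` (fact seat of
`Literature.Topology.FourManifolds.isOrientedBordant_of_isEmpty_of_signature_eq_zero`, Kirby
1989, Cor. IX.2 with VIII Thm 1(A), whose proof makes a closed 4-manifold simply connected by
finitely many surgeries on circles — finitely many because `π₁` of a compact manifold is finitely
generated).

* `fundamentalGroup_fg_of_compactSpace_chartedSpace` — **for a compact Hausdorff topological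
  manifold `V` (charted on a finite-dimensional real normed space) and every `x₀`,
  `π₁(V, x₀)` is finitely generated.**

Proof (Hatcher, *Algebraic Topology* (2002), proof of Thm. 1.20 via Lemma 1.15 with a Lebesgue
number; the statement is e.g. Thm. 7.21 of Lee's *Introduction to Topological Manifolds*
(2011)): `V` is metrizable; let
`δ` be a Lebesgue number of the cover of `V` by chart balls `W` (simply connected open sets);
cover `V` by finitely many path-connected open sets `U` of diameter `< δ` (path components of
metric balls of radius `δ/2`, open by local path-connectedness); two meeting `U`'s lie in a ball
of radius `δ`, hence in one `W`, so every loop in their union is null-homotopic in `V`, and the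
generation theorem `fundamentalGroup_fg_of_finite_cover` (`FiniteCover.lean`) applies.
Everything is proved; no definitions, no named facts.

## References

* A. Hatcher, *Algebraic Topology* (2002), Lemma 1.15 and proof of Thm. 1.20. [HatcherAT2002]
-/

noncomputable section

open scoped Manifold
open Set Function Metric Topology TopologicalSpace

namespace Literature.AlgebraicTopology.FundamentalGroup

/-- **The fundamental group of a compact manifold is finitely generated** (Hatcher 2002, proof
of Thm. 1.20 with Lemma 1.15): for a compact Hausdorff space `V` charted on a
finite-dimensional real normed space `E` and every base point `x₀`, `π₁(V, x₀)` is finitely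
generated. [cite: HatcherAT2002, Lemma 1.15 and proof of Thm. 1.20] -/
theorem fundamentalGroup_fg_of_compactSpace_chartedSpace {E : Type*} [NormedAddCommGroup E]
    [NormedSpace ℝ E] [FiniteDimensional ℝ E] {V : Type*} [TopologicalSpace V] [T2Space V]
    [CompactSpace V] [ChartedSpace E V] (x₀ : V) :
    Group.FG (_root_.FundamentalGroup V x₀) := by
  classical
  -- ### a metric
  letI : MetrizableSpace V := Manifold.metrizableSpace 𝓘(ℝ, E) V
  letI : MetricSpace V := TopologicalSpace.metrizableSpaceMetric V
  haveI := ChartedSpace.locallyPathConnectedSpace E V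
  -- ### chart balls: simply connected open sets `W x ∋ x`
  have hW : ∀ x : V, ∃ W : Set V, IsOpen W ∧ x ∈ W ∧ IsSimplyConnected W := by
    intro x
    set φ := chartAt E x with hφ
    obtain ⟨r, hr, hball⟩ : ∃ r > 0, ball (φ x) r ⊆ φ.target :=
      Metric.isOpen_iff.1 φ.open_target (φ x) (φ.map_source (mem_chart_source E x))
    have hsrc : ball (φ x) r ⊆ φ.symm.source := by rwa [φ.symm_source]
    refine ⟨φ.symm '' ball (φ x) r, φ.symm.isOpen_image_of_subset_source isOpen_ball hsrc,
      ⟨φ x, mem_ball_self hr, φ.left_inv (mem_chart_source E x)⟩, ?_⟩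
    haveI : ContractibleSpace ↥(ball (φ x) r) :=
      (convex_ball (φ x) r).contractibleSpace ⟨φ x, mem_ball_self hr⟩
    have e : ↥(ball (φ x) r) ≃ₜ ↥(φ.symm '' ball (φ x) r) :=
      φ.symm.homeomorphOfImageSubsetSource hsrc rfl
    exact e.toHomotopyEquiv.simplyConnectedSpace_iff.1 inferInstance
  choose W hWo hxW hWsc using hW
  -- ### a Lebesgue number `δ` of the cover by chart balls
  obtain ⟨δ, hδ, hleb⟩ := lebesgue_number_lemma_of_metric isCompact_univ hWo
    (fun y _ => mem_iUnion.2 ⟨y, hxW y⟩)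
  -- ### small path-connected open neighbourhoods
  set U : V → Set V := fun y => pathComponentIn (ball y (δ / 2)) y with hUdef
  have hUo : ∀ y, IsOpen (U y) := fun y => isOpen_ball.pathComponentIn y
  have hyU : ∀ y, y ∈ U y := fun y => mem_pathComponentIn_self (mem_ball_self (by positivity))
  have hUpc : ∀ y, IsPathConnected (U y) := fun y =>
    isPathConnected_pathComponentIn (mem_ball_self (by positivity))
  have hUball : ∀ y, U y ⊆ ball y (δ / 2) := fun y => pathComponentIn_subset
  -- ### a finite subcover
  obtain ⟨t, ht⟩ := isCompact_univ.elim_finite_subcover U hUo (fun y _ => mem_iUnion.2 ⟨y, hyU y⟩)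
  refine fundamentalGroup_fg_of_finite_cover (ι := ↥t) (fun k => U k) (fun k => hUo k)
    (fun k => hUpc k) ?_ ?_ x₀
  · refine eq_univ_of_univ_subset fun y hy => ?_
    obtain ⟨k, hk⟩ := mem_iUnion.1 (ht hy)
    obtain ⟨hkt, hyk⟩ := mem_iUnion.1 hk
    exact mem_iUnion.2 ⟨⟨k, hkt⟩, hyk⟩
  · rintro j k ⟨z, hzj, hzk⟩ y γ hγ
    obtain ⟨x, hx⟩ := hleb z (mem_univ z)
    refine homotopic_refl_of_range_subset (hWsc x) γ (hγ.trans ((union_subset ?_ ?_).trans hx))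
    · intro w hw
      rw [mem_ball]
      have h1 := mem_ball.1 (hUball _ hw)
      have h2 := mem_ball.1 (hUball _ hzj)
      calc dist w z ≤ dist w (j : V) + dist (j : V) z := dist_triangle _ _ _
        _ < δ / 2 + δ / 2 := add_lt_add h1 (by rwa [dist_comm])
        _ = δ := by ring
    · intro w hw
      rw [mem_ball]
      have h1 := mem_ball.1 (hUball _ hw)
      have h2 := mem_ball.1 (hUball _ hzk)
      calc dist w z ≤ dist w (k : V) + dist (k : V) z := dist_triangle _ _ _
        _ < δ / 2 + δ / 2 := add_lt_add h1 (by rwa [dist_comm])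
        _ = δ := by ring

end Literature.AlgebraicTopology.FundamentalGroup
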